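import Summits.BirchSwinnertonDyer.BirchSwinnertonDyer.Theorems.PrintCFramBottomClassIndexLawFiveLeSelmerCountUnconditional
import HarnessLib

/-!
# Route `PrintCFram`, crux C2 `BottomClassIndexLawFiveLe` (stmt-BirchSwinnertonDyer-20372), line
# `eisenstein-resource-bdp-line` (registry v24, stubs B1-level `stub_bsdp_of_level` / B1-sha⁰ `stub_bsdp_of_sha_levelZero`):
# **THE STRICT `p`-RANK LOWER BOUND — NO CASE HYPOTHESIS, NO LEVEL HYPOTHESIS, NO NAMED FACT** — on EVERY rank-one CM-ramified
# member whose odd line is the sub: **`p^r ≤ #Sel_p(W/ℚ)` and `p^{r−1} ≤ #Ш(W/ℚ)[p]` whenever `p^r ≤ #(e_{ω∘ψ̄}(ℤ_p ⊗ Cl K))[p]`**;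
# in particular `rank_p e_{θ_e} ≥ 2 ⟹ Ш(W)[p] ≠ 0` with no alignment and no level condition
# (cell `bsd-print-cfram`, width seat `bsd-line-cfram-p1-w7` g5; helper `--supports` 20372; 0 defs, 0 facts, 0 sorry; UNCONDITIONAL)

HONEST FRAMING. Nothing about BSD is proved here; no summit statement is proved by this seat; no stub of the registered skeleton is
closed. The two earlier lower bounds of this seat needed a local input to push RELAXED classes of the odd line `Φ` into `Sel_p`: (LA)
(`…LowerBoundPRank`, p689980: `p^{r+1} ≤ #Sel_p`) or a LEVEL-0 generator (`…LowerBoundPRankLevelZero`, p690567: `p^r ≤ #Ш[p]`). The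
STRICT classes (locally trivial at `p`) need neither: `R_str(Φ) ↪ Sel_p(W/ℚ)` always (strict at `p` ⟹ the local Selmer condition holds
trivially; injective because `H⁰(Γ_ℚ, Φ.Quot) = 0` — both steps are inside w2 g10's `…LowerBound` / w2 g11's `…LevelZero` proofs, isolated
here), and `#R_str(Φ) ≥ #R_rel(Φ)/p = p^r` (w2 g11's local index bound, now unconditional: `natCard_h1Unramified_le_prime_mul_natCard_strictEP`,
+ the reflection equality / family supply `#R_rel(Φ) ≥ p^{r+1}`). So one factor `p` is lost against the (LA)/level-0 versions, and
nothing is assumed.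

* §1 **`natCard_strict_le_natCard_selmerGroup`** — `W/ℚ` elliptic, `p` odd, `Φ ≤ W[p]` stable with `Φ.Quot^{Γ_ℚ} = 0`, `W(ℚ_ℓ)[p] = 0` at
  the bad `ℓ ≠ p`, `v ∋ p` ⊢ `#(h1Unramified Φ.Sub S_p ⊓ ker res_{D_v}) ≤ #Sel_p(W/ℚ)` (no alignment, no level, no named fact).
* §2 **`pow_le_natCard_selmerGroup_of_pow_le_evenChiTorsion_of_cmRamified`** — hypotheses of p685598 §3 MINUS (LA) (class member of rank
  one, `v ∋ p`, odd line `Φ` with character `θ`, reflection field `K`, `χ̄`, `ψ̄ = ā χ̄⁻¹ ≠ 1`) and `p^r ≤ #(e_{ω∘ψ̄}(ℤ_p ⊗ Cl K))[p]` ⊢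
  **`p^r ≤ #Sel_p(W/ℚ)` ∧ `p^{r−1} ≤ #(Ш(W/ℚ) ⊓ Ш[p])`**; `exists_sha_ne_zero_of_sq_le_evenChiTorsion_of_cmRamified` — `p² ≤ #(e_{ω∘ψ̄})[p]`
  (even `p`-rank `≥ 2`) ⟹ `∃ c ∈ Ш(W/ℚ), c ≠ 0 ∧ p • c = 0`.

THEOREMS ONLY; no definition, no named fact, no `sorry`. References: [Washington1997] §10.2 (Thm. 10.9); [Gras2003] Ch. II §5.4;
[MilneADT2006] I Thm. 2.8, Prop. 3.8; [SilvermanAEC2009] Thm. X.4.2; [SerreGaloisCohomology1997] I.§2.6 (b), I.§5.1.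
-/

set_option autoImplicit false
-- `…BirchSwinnertonDyer.BirchSwinnertonDyer.Theorems…` is the problem's mandated namespace (D-0017).
set_option linter.dupNamespace false

noncomputable section

open scoped Classical

namespace Summit.BirchSwinnertonDyer.BirchSwinnertonDyer.Theorems.PrintCFram.SelmerCount

open NumberField IsDedekindDomain Field WeierstrassCurve
open Literature.NumberTheory.EllipticCurves Literature.NumberTheory.GaloisRepresentations
  Literature.NumberTheory.EllipticCurves.GreenbergSelmer Literature.NumberTheory.EllipticCurves.Rank1Residual
  Literature.NumberTheory.NumberFields
open Summit.BirchSwinnertonDyer.BirchSwinnertonDyer.Theorems.PrintCFram.LevelDictionary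
open Summit.BirchSwinnertonDyer.Rank1Residual.X2.ResidualDevissageModules
open scoped ContRepresentation

/-! ## §1 `R_str(Φ) ↪ Sel_p(W/ℚ)` — always -/

section Inject

variable (W : WeierstrassCurve ℚ) [W.IsElliptic]
variable {p : ℕ} [hp : Fact p.Prime]
  (Φ : StableSubgroup (absoluteGaloisGroup ℚ) (geomTorsion W (p : ℤ)))

/-- **`R_str(Φ) ↪ Sel_p(W/ℚ)`, NO alignment, NO level, NO named fact.** `W/ℚ` elliptic, `p` odd, `v ∋ p`; `Φ ≤ W[p]` stable with
`Φ.Quot^{Γ_ℚ} = 0`; `W(ℚ_ℓ)[p] = 0` at the bad `ℓ ≠ p`. THEN `#(h1Unramified Φ.Sub S_p ⊓ ker res_{D_v}) ≤ #Sel_p(W/ℚ)`: for a STRICT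
class `[w]` (unramified outside `p`, restriction to `D_v` a coboundary) the push-forward `ι_*[w]` is a Selmer class — at good `ℓ ≠ p` by
unramifiedness, at bad `ℓ ≠ p` the condition is empty, at `p` the restriction to `Γ_{ℚ_v}` is a coboundary hence in the local Kummer image
(`incl_mem_selmerGroup_of_coaligned` with its `hCO` supplied by strictness, as in w2 g11's `natCard_strict_le_natCard_map_selmerGroup_of_level_zero`)
— and `ι_*` is injective since `H⁰(Γ_ℚ, Φ.Quot) = 0` (`exists_eq_smul_sub_of_push_principal`, as in w2 g10's
`natCard_h1Unramified_le_natCard_selmerGroup_of_coaligned`). [cite: MilneADT2006, Ch. I Prop. 3.8 and §6] [cite: SilvermanAEC2009, Thm. X.4.2]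
[cite: SerreGaloisCohomology1997, I.§2.6 (b) and I.§5.1] -/
theorem natCard_strict_le_natCard_selmerGroup (hp2 : p ≠ 2)
    (hQΓ : ∀ q : Φ.Quot, (∀ g : absoluteGaloisGroup ℚ, g • q = q) → q = 0)
    (hbad : ∀ v' : HeightOneSpectrum (𝓞 ℚ), ¬ W.HasGoodReductionAt v' → ((p : ℕ) : 𝓞 ℚ) ∉ v'.asIdeal →
      ∀ Q : (W.baseChange (v'.adicCompletion ℚ)).toAffine.Point, p • Q = 0 → Q = 0)
    {v : HeightOneSpectrum (𝓞 ℚ)} (hpv : ((p : ℕ) : 𝓞 ℚ) ∈ v.asIdeal) :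
    Nat.card ↥(h1Unramified Φ.Sub {v' : HeightOneSpectrum (𝓞 ℚ) | ((p : ℕ) : 𝓞 ℚ) ∈ v'.asIdeal} ⊓
        subgroupResKer Φ.Sub (decomp v)) ≤
      Nat.card (selmerGroup W (p : ℤ)) := by
  have hp0 : ((p : ℕ) : ℤ) ≠ 0 := by exact_mod_cast hp.out.ne_zero
  haveI : Finite (selmerGroup W (p : ℤ)) := W.finite_selmerGroup_holds hp0
  set Γ := absoluteGaloisGroup ℚ
  set Sp : Set (HeightOneSpectrum (𝓞 ℚ)) := {v' | ((p : ℕ) : 𝓞 ℚ) ∈ v'.asIdeal} with hSp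
  -- `ι_* = H¹(Φ.incl)`
  let ιH : discreteH1 Γ Φ.Sub →+ galH1Torsion W (p : ℤ) :=
    (ContinuousCohomology.map (ContinuousMonoidHom.id Γ)
      (resHomOfEquivariant (ContinuousMonoidHom.id Γ) Φ.incl Φ.incl_smul) 1).hom.toLinearMap.toAddMonoidHom
  have hιH : ∀ w, ιH (oneCocycleClass _ w) = oneCocycleClass (discreteTopRep Γ (geomTorsion W (p : ℤ)))
      (contOneCocycles.pullback (ContinuousMonoidHom.id Γ)
        (resHomOfEquivariant (ContinuousMonoidHom.id Γ) Φ.incl Φ.incl_smul) w) := fun w ↦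
    map_oneCocycleClass _ _ _ w
  -- the unique place above `p`
  have hvv : ∀ v' : HeightOneSpectrum (𝓞 ℚ), ((p : ℕ) : 𝓞 ℚ) ∈ v'.asIdeal → v' = v := fun v' hv' ↦
    Rat.HeightOneSpectrum.primesEquiv.injective (Subtype.ext
      ((LevelDictionary.primesEquiv_eq_of_natCast_mem v' hp.out hv').trans
        (LevelDictionary.primesEquiv_eq_of_natCast_mem v hp.out hpv).symm))
  -- `ι_*` maps `R_str(Φ.Sub)` into `Sel_p`
  have hmem : ∀ c ∈ h1Unramified Φ.Sub Sp ⊓ subgroupResKer Φ.Sub (decomp v), ιH c ∈ selmerGroup W (p : ℤ) := by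
    intro c hc
    obtain ⟨hcU, hcD⟩ := AddSubgroup.mem_inf.mp hc
    obtain ⟨w, rfl⟩ := oneCocycleClass_surjective _ c
    rw [hιH]
    refine incl_mem_selmerGroup_of_coaligned W p hp2 Φ hbad w (fun v' 𝔓 hpv' h𝔓 ↦ ?_) (fun v' hpv' ↦ ?_)
    · have h := mem_h1Unramified_iff.1 hcU v' (by simpa [hSp] using hpv') 𝔓 h𝔓
      obtain ⟨s, hs⟩ := (oneCocycleClass_mem_subgroupResKer_iff _ w).1 h
      exact ⟨s, fun g hg ↦ hs ⟨g, hg⟩⟩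
    · -- strict at `p`: the restriction to `Γ_{ℚ_v}` is a coboundary, hence in `L_p`
      obtain rfl := hvv v' hpv'
      obtain ⟨s, hs⟩ := (oneCocycleClass_mem_subgroupResKer_iff _ w).1 hcD
      refine mem_selmerLocalKer_of_res_torsionGaloisModule_eq_zero W (v'.adicCompletion ℚ) _ ?_
      rw [WeierstrassCurve.res_torsionGaloisModule_oneCocycleClass]
      refine (oneCocycleClass_eq_zero_iff _ _).mpr ⟨Φ.incl s, fun σ ↦ ?_⟩
      have hσ : absGaloisRestrict ℚ (v'.adicCompletion ℚ) σ ∈ decomp v' := ⟨σ, rfl⟩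
      have h1 : Φ.incl (w.1 (absGaloisRestrict ℚ (v'.adicCompletion ℚ) σ)) =
          absGaloisRestrict ℚ (v'.adicCompletion ℚ) σ • Φ.incl s - Φ.incl s := by
        rw [hs ⟨_, hσ⟩, map_sub, Φ.incl_smul]
      exact h1
  -- `ι_*` is injective (`H⁰(Γ_ℚ, Φ.Quot) = 0`)
  have hker : ∀ m : geomTorsion W (p : ℤ), Φ.proj m = 0 → ∃ s : Φ.Sub, Φ.incl s = m := fun m hm ↦
    ⟨⟨m, (QuotientAddGroup.eq_zero_iff m).mp hm⟩, rfl⟩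
  have hπι : ∀ s : Φ.Sub, Φ.proj (Φ.incl s) = 0 := fun s ↦ (QuotientAddGroup.eq_zero_iff _).mpr s.2
  have hinj : ∀ c, ιH c = 0 → c = 0 := by
    intro c hc
    obtain ⟨w, rfl⟩ := oneCocycleClass_surjective _ c
    rw [hιH, oneCocycleClass_eq_zero_iff] at hc
    obtain ⟨m₀, hm₀⟩ := hc
    obtain ⟨s₀, hs₀⟩ := exists_eq_smul_sub_of_push_principal Φ.incl Φ.proj Φ.incl_smul Φ.proj_smul
      Φ.incl_injective hπι hker hQΓ w.1 (m₀ := m₀) (fun g ↦ by rw [← pullback_id_apply]; exact hm₀ g)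
    exact (oneCocycleClass_eq_zero_iff _ w).2 ⟨s₀, hs₀⟩
  -- count
  refine Nat.card_le_card_of_injective (fun c : ↥(h1Unramified Φ.Sub Sp ⊓ subgroupResKer Φ.Sub (decomp v)) ↦
    (⟨ιH c.1, hmem c.1 c.2⟩ : selmerGroup W (p : ℤ))) fun x y hxy ↦ ?_
  simp only [Subtype.mk.injEq] at hxy
  have h0 : ιH (x.1 - y.1) = 0 := by rw [map_sub, hxy, sub_self]
  exact Subtype.ext (sub_eq_zero.1 (hinj _ h0))

end Inject

/-! ## §2 On the CM-ramified class: `p^r ≤ #Sel_p`, `p^{r−1} ≤ #Ш[p]` with no case / level hypothesis -/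

section Class

variable (W : WeierstrassCurve ℚ) [W.IsElliptic] [W.IsGloballyMinimal]
variable {p : ℕ} [hp : Fact p.Prime]

/-- **THE STRICT `p`-RANK LOWER BOUND — NO (LA), NO LEVEL, NO NAMED FACT.** Class member `W/ℚ` (globally minimal, CM, `CMRamified W p`,
`p ≥ 5`) of rank one; `v ∋ p`; `Φ ≤ W[p]` a stable line of order `p` with character `θ : Γ_ℚ →* 𝔽_pˣ`; `K` a CM field, Galois over `ℚ`,
`p ∤ [K:ℚ]`, `θ(res Γ_K) = 1`, `ζ ∈ K` a primitive `p`-th root of unity with `σ ζ = ζ^{a σ}`; `χ̄` the DESCENT of `θ`, ODD; `ψ̄` its reflection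
(`ψ̄ σ = a σ · χ̄(σ)⁻¹`), `ψ̄ ≠ 1`; and `p^r ≤ #(e_{ω∘ψ̄}(ℤ_p ⊗ Cl(𝓞 K)))[p]` — the hypotheses of w2 g11's p685598 §3 MINUS (LA), with
`classGroupChiCard ≠ 1` replaced by the `p`-rank bound. THEN **`p^r ≤ #Sel_p(W/ℚ)`** and **`p^{r−1} ≤ #(Ш(W/ℚ) ⊓ Ш[p])`**:
`p^{r+1} ≤ #R_rel(Φ)` (`r + 1` independent admissible Kummer characters, family supply count), `#R_rel(Φ) ≤ p · #R_str(Φ)` (Tate's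
local Euler characteristic, unconditional), `R_str(Φ) ↪ Sel_p` (§1), `#Sel_p = p · #Ш[p]` (rank one, no `p`-torsion). So
`dim_𝔽_p Ш(W)[p] ≥ rank_p e_{θ_e} − 1` on EVERY such member, and `≥ rank_p e_{θ_e}` under (LA) (p689980) or at level `0` (p690567).
[cite: Washington1997, §10.2 (Thm. 10.9)] [cite: Gras2003, Ch. II §5.4] [cite: MilneADT2006, Ch. I §2 Thm. 2.8] [cite: SilvermanAEC2009, Thm. X.4.2] -/
theorem pow_le_natCard_selmerGroup_of_pow_le_evenChiTorsion_of_cmRamified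
    (hCM : W.HasCM) (hram : CMRamified W p) (h5 : 5 ≤ p) (hrank : W.mordellWeilRank = 1)
    {v : HeightOneSpectrum (𝓞 ℚ)} (hpv : ((p : ℕ) : 𝓞 ℚ) ∈ v.asIdeal)
    (Φ : StableSubgroup (absoluteGaloisGroup ℚ) (geomTorsion W (p : ℤ))) (hcard : Nat.card Φ.Sub = p)
    (θ : absoluteGaloisGroup ℚ →* (ZMod p)ˣ)
    (hθ : ∀ (g : absoluteGaloisGroup ℚ) (s : Φ.Sub), g • s = (((θ g : ZMod p).val : ℕ) : ℤ) • s)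
    {K : Type} [Field K] [NumberField K] [IsCMField K] [IsGalois ℚ K] (hpK : ¬ p ∣ Module.finrank ℚ K)
    (hrK : ∀ σ : absoluteGaloisGroup K, θ (absGaloisRestrict ℚ K σ) = 1)
    {ζ : K} (hζ : IsPrimitiveRoot ζ p) (a : (K ≃ₐ[ℚ] K) → ℕ) (ha : ∀ σ₀ : K ≃ₐ[ℚ] K, σ₀ ζ = ζ ^ a σ₀)
    (χb : (K ≃ₐ[ℚ] K) →* (ZMod p)ˣ) (hχb : ∀ γ : absoluteGaloisGroup ℚ, χb (absGaloisQuot ℚ K γ) = θ γ)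
    (hoddχ : χb ((IsCMField.complexConj K).restrictScalars ℚ) = -1)
    (ψb : (K ≃ₐ[ℚ] K) →* (ZMod p)ˣ) (hψb1 : ψb ≠ 1)
    (hψb : ∀ σ : K ≃ₐ[ℚ] K, ((ψb σ : (ZMod p)ˣ) : ZMod p) = (a σ : ZMod p) * (((χb σ)⁻¹ : (ZMod p)ˣ) : ZMod p)) {r : ℕ}
    (hr : p ^ r ≤ Nat.card {y : ↥(classGroupChiComponent ℚ K p
      (fun g => ((((Kato2004.teichmullerChar p).comp ψb) g : ℤ_[p]ˣ) : ℤ_[p]))) // p • y = 0}) :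
    p ^ r ≤ Nat.card (selmerGroup W (p : ℤ)) ∧
      p ^ (r - 1) ≤ Nat.card (W.sha ⊓ AddSubgroup.torsionBy W.galH1 p : AddSubgroup W.galH1) := by
  have hpr : p.Prime := hp.out
  have hp2 : p ≠ 2 := by omega
  have hp0 : ((p : ℕ) : ℤ) ≠ 0 := by exact_mod_cast hpr.ne_zero
  -- `p^{r+1} ≤ #R_rel(Φ)`: `r + 1` independent admissible characters and the family supply count
  obtain ⟨κ, hκ, hind⟩ :=
    KummerRadical.exists_independent_kummer_characters_of_odd_character_of_pow_le hpK hζ a ha χb hoddχ ψb hψb1 hψb hr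
  have hSpfin : {v' : HeightOneSpectrum (𝓞 ℚ) | ((p : ℕ) : 𝓞 ℚ) ∈ v'.asIdeal}.Finite := by
    convert finite_setOf_intCast_mem_asIdeal (K := ℚ) hp0 using 1
    ext v'
    simp only [Set.mem_setOf_eq, Int.cast_natCast]
  have hcont : ∀ s : Φ.Sub, Continuous fun g : absoluteGaloisGroup ℚ ↦ g • s :=
    Φ.continuous_smul_sub (LevelDictionary.continuous_smul_geomTorsion W (p : ℤ))
  have hrel := pow_card_le_natCard_h1Unramified_of_characters hcard hcont θ hθ hpK hrK hSpfin κ (fun j => (hκ j).1)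
    (fun j u hu => (hκ j).2.1 u (natCast_not_mem_of_under_not_mem hu)) (fun j γ σ => by rw [(hκ j).2.2 γ σ, hχb]) hind
  rw [Fintype.card_option, Fintype.card_fin, pow_succ'] at hrel
  -- `#R_rel ≤ p · #R_str` (Tate, unconditional) ⟹ `p^r ≤ #R_str`
  have hSD : ∀ s : Φ.Sub, (∀ g ∈ decomp v, g • s = s) → s = 0 := fun s hs ↦
    LevelDictionaryAlpha.sub_eq_zero_of_forall_inertia_smul_eq_at_p W Φ hCM h5 hram hcard hpv
      (adicCompletionPrime_mem_primesAbove ℚ v) s fun g hg ↦ hs g (by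
        have h := Ideal.inertia_le_decompositionSubgroup (absoluteGaloisGroup ℚ) (adicCompletionPrime ℚ v) hg
        rw [decompositionSubgroup_adicCompletionPrime_eq_range] at h
        exact h)
  have hSμ := exists_decomp_homothety_ne_cyclotomic_of_cmRamified W hCM h5 hram Φ hcard hpv
  have hcount := natCard_h1Unramified_le_prime_mul_natCard_strictEP W v Φ hpv hcard hSD hSμ
    {v' : HeightOneSpectrum (𝓞 ℚ) | ((p : ℕ) : 𝓞 ℚ) ∈ v'.asIdeal}
  have hstr : p ^ r ≤ Nat.card ↥(h1Unramified Φ.Sub {v' : HeightOneSpectrum (𝓞 ℚ) | ((p : ℕ) : 𝓞 ℚ) ∈ v'.asIdeal} ⊓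
      subgroupResKer Φ.Sub (decomp v)) :=
    Nat.le_of_mul_le_mul_left (hrel.trans hcount) hpr.pos
  -- `R_str ↪ Sel_p` (§1)
  have hQΓ : ∀ q : Φ.Quot, (∀ g : absoluteGaloisGroup ℚ, g • q = q) → q = 0 := fun q hq ↦
    LevelDictionaryAlpha.quot_eq_zero_of_forall_inertia_smul_eq_at_p W Φ hCM h5 hram hcard hpv
      (adicCompletionPrime_mem_primesAbove ℚ v) q fun g _ ↦ hq g
  have hbad : ∀ v' : HeightOneSpectrum (𝓞 ℚ), ¬ W.HasGoodReductionAt v' → ((p : ℕ) : 𝓞 ℚ) ∉ v'.asIdeal →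
      ∀ Q : (W.baseChange (v'.adicCompletion ℚ)).toAffine.Point, p • Q = 0 → Q = 0 :=
    fun v' hg hpv' ↦ LevelDictionaryAlpha.forall_prime_nsmul_eq_zero_adicCompletion_of_bad (K := ℚ) W hCM hram h5 hpv' hg
  have hsel : p ^ r ≤ Nat.card (selmerGroup W (p : ℤ)) :=
    hstr.trans (natCard_strict_le_natCard_selmerGroup W Φ hp2 hQΓ hbad hpv)
  refine ⟨hsel, ?_⟩
  -- `#Sel_p = p · #Ш[p]`
  have htors : ∀ P : W.toAffine.Point, p • P = 0 → P = 0 := LevelDictionary.forall_nsmul_eq_zero_of_cmRamified W p hCM h5 hram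
  rw [ParitySplit.natCard_selmerGroup_eq_mul_of_rank_one W p hrank htors] at hsel
  rcases Nat.eq_zero_or_pos r with h0 | hpos
  · rw [h0, Nat.zero_sub, pow_zero]
    exact one_le_natCard_sha_inf_torsionBy W
  · have h1 : p ^ r = p * p ^ (r - 1) := by rw [← pow_succ', Nat.sub_add_cancel hpos]
    rw [h1] at hsel
    exact Nat.le_of_mul_le_mul_left hsel hpr.pos

/-- **EVEN `p`-RANK `≥ 2` ⟹ `Ш(W/ℚ)[p] ≠ 0` — NO (LA), NO LEVEL, NO NAMED FACT.** With the data of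
`pow_le_natCard_selmerGroup_of_pow_le_evenChiTorsion_of_cmRamified`: if `p² ≤ #(e_{ω∘ψ̄}(ℤ_p ⊗ Cl(𝓞 K)))[p]` then `Ш(W/ℚ)` has a
non-zero element killed by `p`. So the B1-sha premise holds on every rank-one member (odd line = sub) with `rank_p e_{θ_e} ≥ 2`, whatever
its level and alignment; the only members where level / alignment decide are those with `rank_p e_{θ_e} = 1`.
[cite: Washington1997, §10.2 (Thm. 10.9)] [cite: SilvermanAEC2009, Thm. X.4.2] -/
theorem exists_sha_ne_zero_of_sq_le_evenChiTorsion_of_cmRamified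
    (hCM : W.HasCM) (hram : CMRamified W p) (h5 : 5 ≤ p) (hrank : W.mordellWeilRank = 1)
    {v : HeightOneSpectrum (𝓞 ℚ)} (hpv : ((p : ℕ) : 𝓞 ℚ) ∈ v.asIdeal)
    (Φ : StableSubgroup (absoluteGaloisGroup ℚ) (geomTorsion W (p : ℤ))) (hcard : Nat.card Φ.Sub = p)
    (θ : absoluteGaloisGroup ℚ →* (ZMod p)ˣ)
    (hθ : ∀ (g : absoluteGaloisGroup ℚ) (s : Φ.Sub), g • s = (((θ g : ZMod p).val : ℕ) : ℤ) • s)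
    {K : Type} [Field K] [NumberField K] [IsCMField K] [IsGalois ℚ K] (hpK : ¬ p ∣ Module.finrank ℚ K)
    (hrK : ∀ σ : absoluteGaloisGroup K, θ (absGaloisRestrict ℚ K σ) = 1)
    {ζ : K} (hζ : IsPrimitiveRoot ζ p) (a : (K ≃ₐ[ℚ] K) → ℕ) (ha : ∀ σ₀ : K ≃ₐ[ℚ] K, σ₀ ζ = ζ ^ a σ₀)
    (χb : (K ≃ₐ[ℚ] K) →* (ZMod p)ˣ) (hχb : ∀ γ : absoluteGaloisGroup ℚ, χb (absGaloisQuot ℚ K γ) = θ γ)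
    (hoddχ : χb ((IsCMField.complexConj K).restrictScalars ℚ) = -1)
    (ψb : (K ≃ₐ[ℚ] K) →* (ZMod p)ˣ) (hψb1 : ψb ≠ 1)
    (hψb : ∀ σ : K ≃ₐ[ℚ] K, ((ψb σ : (ZMod p)ˣ) : ZMod p) = (a σ : ZMod p) * (((χb σ)⁻¹ : (ZMod p)ˣ) : ZMod p))
    (hsq : p ^ 2 ≤ Nat.card {y : ↥(classGroupChiComponent ℚ K p
      (fun g => ((((Kato2004.teichmullerChar p).comp ψb) g : ℤ_[p]ˣ) : ℤ_[p]))) // p • y = 0}) :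
    ∃ c ∈ W.sha, c ≠ 0 ∧ p • c = 0 := by
  have hpr : p.Prime := hp.out
  obtain ⟨-, hN⟩ := pow_le_natCard_selmerGroup_of_pow_le_evenChiTorsion_of_cmRamified W hCM hram h5 hrank hpv Φ hcard θ hθ hpK hrK
    hζ a ha χb hχb hoddχ ψb hψb1 hψb hsq
  rw [show 2 - 1 = 1 from rfl, pow_one] at hN
  have hsha : 1 < Nat.card (W.sha ⊓ AddSubgroup.torsionBy W.galH1 p : AddSubgroup W.galH1) := hpr.one_lt.trans_le hN
  haveI : Finite (W.sha ⊓ AddSubgroup.torsionBy W.galH1 p : AddSubgroup W.galH1) := Nat.finite_of_card_ne_zero (by omega)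
  obtain ⟨x, y, hxy⟩ := Finite.one_lt_card_iff_nontrivial.mp hsha
  have hx : ∃ z : (W.sha ⊓ AddSubgroup.torsionBy W.galH1 p : AddSubgroup W.galH1), z ≠ 0 := by
    by_cases h : x = 0
    · exact ⟨y, fun hy ↦ hxy (h.trans hy.symm)⟩
    · exact ⟨x, h⟩
  obtain ⟨z, hz⟩ := hx
  obtain ⟨hzsha, hztor⟩ := AddSubgroup.mem_inf.mp z.2
  exact ⟨z.1, hzsha, fun h ↦ hz (Subtype.ext h), AddSubgroup.torsionBy.nsmul_iff.mp hztor⟩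

end Class

end Summit.BirchSwinnertonDyer.BirchSwinnertonDyer.Theorems.PrintCFram.SelmerCount

end
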